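import Literature.MathematicalPhysics.QuantumFieldTheory.Balaban1983to89.B2Eq265HiggsRegion

/-!
# `Balaban1983to89.B2Eq265GaugedLipschitz` — [Balaban1982Higgs2] Lemma 2.4, the two displayed lines of p. 573 before (2.75), AS PRINTED
# (render re-read by the row owner r02, 2026-08-23): «Now let us consider the restrictions (2.55) on the field φ. The estimates of the
# covariant derivatives give us |U(A₀(⟨y′, y″⟩))φ(y″) − φ(y′)| ≦ O(1)p(Lᵏε). After the gauge transformation we finally get
# |U(A₀(⟨y′, y″⟩))U(A₀(Γ_{y″,y}))φ′(y″) − U(A₀(Γ_{y′,y}))φ′(y′)| = |φ′(y″) − φ′(y′)| ≦ O(1)p(Lᵏε).» — the first line DERIVED from a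
# (2.55)₃-type per-bond bound at `A^{(k)}` (`|Ā^{(k)} − A₀| ≤ s` on `□`), the second TELESCOPED ALONG LATTICE PATHS in the box `□₁`
# (the gauged field `φ′` is Lipschitz about `ȳ` with constant `d·λ₁`); hence **(2.65) on the (Higgs)₂,₃ carrier of record with
# hypothesis (c) in covariant per-bond form** (`eq265_higgs_region_cov`)

statement-level skeleton of published theorems with citation tags; proofs where landed; nothing here is a claim
about the Yang–Mills mass gap

PDF held: `paper:balaban1982-cmp86-higgs23-ii` (journal page = PDF page + 554), p. 573 [PDF 19] (text layer p0019 L18–24).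

CITATION HEADER (lean-in-tree rule).  T. Bałaban, *(Higgs)₂,₃ quantum fields in a finite volume. II. An upper bound*,
Commun. Math. Phys. **86** (1982) 555–594, doi:10.1007/bf01214890 [Balaban1982Higgs2].  Cell `lit-balaban` (HOME
`run/shared/lean/pub/lit-balaban/`), Phase-2 proof seat **p23** gen 21 (unit `lit-balaban-p23-g21`; free-target protocol G.5-34(d), TAKING #6
line HOME/STATUS.md 2026-08-23); SKELETON row **B2.Lem2.4** (fold owner r02, second reader r14; head `proved p250408 · …` UNCHANGED —
cells-only member, brick F6 of the seat's programme: the successor named in F5's HONEST SCOPE (c)).  USED BY NAME, never restated: own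
`B2Eq265HiggsRegion.{eq265_higgs_region, norm_rot_cornerGauge_shift_sub, norm_U_apply_sub_U_apply_le}`, own
`B2Eq273GaugeCovariance.{constVec, cornerGauge}`, p28's `HiggsGaugeInvariance.rot`, the typer's `HiggsLattice.Site.{shift, unshift, tdist}`
and `B2Eq255Concrete.barA` ((2.55) `Ā^{(k)}`), p15's `B2Ineq329ZeroAveraging.blockIter_shiftN_of_le`, `B2Ineq329BlockPoincare.blockIter_toFinest`.

THE ARGUMENT.  On a box of coarse sites `□₁ = q₁ + [0,S₁)ᵈ ⊂ T^{(k)}` (offsets `n_μ(y − q₁) < S₁`, `2S₁ ≤ |T^{(k)}|_μ` so that the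
in-box coordinate differences ARE the torus distances), a field `ψ` whose differences over the bonds of `□₁` are `≤ λ₁` satisfies
`‖ψ(y) − ψ(ȳ)‖ ≤ λ₁·Σ_μ|n_μ(y−q₁) − n_μ(ȳ−q₁)| ≤ λ₁·d·|y − ȳ|` for all `y, ȳ ∈ □₁` (induction on the ℓ¹ offset distance: move one
coordinate of `y` one step towards `ȳ` inside the box).  For the gauged field `ψ = φ′ = U(λ_{q̄})φ` of Lemma 2.4's proof, F5's
`norm_rot_cornerGauge_shift_sub` identifies the bond differences of `φ′` with the covariant differences `‖U_{Lᵏε}(c_μ)φ(y + e_μ) − φ(y)‖`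
of `φ` in the constant field `A₀ = constVec c` — print's first displayed line «|U(A₀(⟨y′, y″⟩))φ(y″) − φ(y′)| ≦ O(1)p(Lᵏε)» is
exactly such a bound — and `|Ā^{(k)}_b − (A₀)_b| ≤ s` on the coarse bonds of `□₂` derives it from the (2.55)₃-type per-bond bound
`‖U_{Lᵏε}(Ā^{(k)}_b)φ(b₊) − φ(b₋)‖ ≤ λ_A` at the field `A^{(k)}` itself («the restrictions (2.55) on the field φ»), with
`λ₁ = λ_A + (Lᵏε)|e|st′`; so (2.65) holds with F5's hypothesis (c) replaced by a covariant per-bond bound at `A^{(k)}`.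

WHAT THIS FILE PROVES (kernel-checked, zero `sorry`; theorems only — NO definition, NO `Prop`-valued fact; axioms standard).
 §1 box arithmetic on `T^{(k)}`: `val_shift_offset`, `val_unshift_offset`, `eq_of_offsets_eq`, `dist_offset_le_tdist`,
    `sum_dist_offset_le`.
 §2 **`lipschitz_of_bond_bound`** (the telescoping: `‖ψ(y) − ψ(ȳ)‖ ≤ λ₁·Σ_μ|Δn_μ|`) and **`lipschitz_about_of_bond_bound`**
    (`≤ λ₁·d·|ȳ − y|`).
 §3 `inside_segment_of_mem`, **`abs_barA_sub_const_le`** (`|Ā^{(k)}_b − (A₀)_b| ≤ s` on the coarse bonds of `□₂`),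
    **`cov_const_of_cov_barA`** (the (2.55)₃-type bound at `Ā^{(k)}` on a coarse bond ⇒ print's first displayed line at `A₀`, cost
    `(Lᵏε)|e|s|φ|`).
 §4 **`eq265_higgs_region_cov`** — (2.65) value clause on the carrier with the covariant per-bond hypothesis
    `‖U_{Lᵏε}(Ā^{(k)}_{⟨y,y+e_μ⟩})φ(y+e_μ) − φ(y)‖ ≤ λ_A` on the bonds of `□₁` (`Ā^{(k)}` = the typer's `barA` (2.55)).

HONEST SCOPE / DIFFERENCES FROM PRINT (recorded, not hidden; one sentence each).  (a) BOX SHAPE: `□₁` must BE a box `q₁ + [0,S₁)ᵈ` of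
coarse sites with `2S₁ ≤ |T^{(k)}|_μ` (hypothesis `∀ y, y ∈ □₁ ↔ n_ν(y − q₁) < S₁`) — the in-box coordinate differences are then
torus distances (`dist_offset_le_tdist`), which the telescoping needs; print's `□₁` (the large blocks within `2r(Lᵏε)` of `y`, a sup-metric
ball) is such a box.  (b) `λ_A` IS NOT DERIVED: print's (2.55)₃ is a bound on `D_{A^{(k)}}φ`; here the per-bond bound
`‖U_{Lᵏε}(Ā^{(k)}_b)φ(b₊) − φ(b₋)‖ ≤ λ_A` on the bonds of `□₁` (`Ā^{(k)}` = the typer's block-averaged `barA` of (2.55),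
`U_{Lᵏε}(Ā^{(k)}_b) = Π U_ε(A_{b′})` over the straight segment by p15's `U_mesh_barA`) is the HYPOTHESIS, its size `λ_A = O(1)p(Lᵏε)` the
user's reading; the step `A^{(k)} → A₀` to print's first displayed line IS done here (`cov_const_of_cov_barA`, cost `(Lᵏε)|e|st′` from
`|A − A₀| ≤ s` on `□`).  (c) Everything else as in F5's HONEST SCOPE (value clause only; `s`, `ρ`, `t′`, the geometry and the regularity of
`A` not derived).  Value = F5's (2.65) with hypothesis (c) in covariant per-bond form at `A^{(k)}`; NOT summit progress.
-/

open scoped BigOperators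

noncomputable section

namespace Literature.MathematicalPhysics.QuantumFieldTheory.Balaban1983to89.B2Eq265GaugedLipschitz

open HiggsLattice (ChargeData covDeriv)
open HiggsAveraging (blockIter toFinest)
open HiggsCovariance (avgQkAdj)
open HiggsCovariancePos (Inside shift_unshift unshift_shift)
open HiggsGaugeInvariance (rot)
open B2Eq255Concrete (bgScalar256 underRegion barA mem_underRegion)
open B2Restr216Lattice (shiftN_succ)
open B2Ineq329ZeroAveraging (blockIter_shiftN_of_le)
open B2Ineq329BlockPoincare (blockIter_toFinest)
open B2Eq273GaugeCovariance (constVec cornerGauge)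
open B2Eq265HiggsRegion (eq265_higgs_region norm_rot_cornerGauge_shift_sub norm_U_apply_sub_U_apply_le)
open HiggsAveraging (shiftN)
open B1Ineq225RegularBox (cellBox)
open B1Ineq234Concrete (distC)
open B1TorusRegionHSizes (IsBigBlockUnion)
open B1TorusCubeCover (half)
open B1TorusCubeLocality26 (rS)

variable {P : HiggsLattice.Params} {N : ℕ} {k : ℕ}

/-! ## §1 Box arithmetic on the coarse torus `T^{(k)}` -/

section BoxArith

/-- one step forward raises the offset by one (inside the torus period). [cite: Balaban1982Higgs1, (1.2) p.604] -/
theorem val_shift_offset (q₁ y : HiggsLattice.Site P k) (μ : Fin P.d)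
    (h : (y μ - q₁ μ).val + 1 < P.sitesPerDir k μ) :
    ((y.shift μ) μ - q₁ μ).val = (y μ - q₁ μ).val + 1 := by
  haveI : NeZero (P.sitesPerDir k μ) := ⟨(P.sitesPerDir_pos k μ).ne'⟩
  have e1 : (y.shift μ) μ - q₁ μ = (y μ - q₁ μ) + 1 := by simp [HiggsLattice.Site.shift]; ring
  have h1 : ((1 : ZMod (P.sitesPerDir k μ))).val = 1 % P.sitesPerDir k μ := ZMod.val_one_eq_one_mod _
  have hmod : 1 % P.sitesPerDir k μ = 1 := Nat.mod_eq_of_lt (by omega)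
  rw [e1, ZMod.val_add, h1, hmod, Nat.mod_eq_of_lt h]

/-- one step backward lowers a positive offset by one. [cite: Balaban1982Higgs1, (1.2) p.604] -/
theorem val_unshift_offset (q₁ y : HiggsLattice.Site P k) (μ : Fin P.d)
    (h : 1 ≤ (y μ - q₁ μ).val) (hn : 1 < P.sitesPerDir k μ) :
    ((y.unshift μ) μ - q₁ μ).val = (y μ - q₁ μ).val - 1 := by
  haveI : Fact (1 < P.sitesPerDir k μ) := ⟨hn⟩
  have e1 : (y.unshift μ) μ - q₁ μ = (y μ - q₁ μ) - 1 := by simp [HiggsLattice.Site.unshift]; ring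
  rw [e1, ZMod.val_sub (by rw [ZMod.val_one]; exact h), ZMod.val_one]

/-- the other coordinates do not move. [cite: Balaban1982Higgs1, (1.2) p.604] -/
theorem shift_apply_of_ne (y : HiggsLattice.Site P k) {μ ν : Fin P.d} (h : ν ≠ μ) : (y.shift μ) ν = y ν := by
  simp [HiggsLattice.Site.shift, h]

/-- the other coordinates do not move. [cite: Balaban1982Higgs1, (1.2) p.604] -/
theorem unshift_apply_of_ne (y : HiggsLattice.Site P k) {μ ν : Fin P.d} (h : ν ≠ μ) : (y.unshift μ) ν = y ν := by
  simp [HiggsLattice.Site.unshift, h]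

/-- two sites with the same offsets from `q₁` coincide. [cite: Balaban1982Higgs1, (1.2) p.604] -/
theorem eq_of_offsets_eq (q₁ y y' : HiggsLattice.Site P k) (h : ∀ μ, (y μ - q₁ μ).val = (y' μ - q₁ μ).val) : y = y' := by
  funext μ
  have e : y μ - q₁ μ = y' μ - q₁ μ := ZMod.val_injective _ (h μ)
  calc y μ = (y μ - q₁ μ) + q₁ μ := by ring
    _ = (y' μ - q₁ μ) + q₁ μ := by rw [e]
    _ = y' μ := by ring

/-- in a box `q₁ + [0,S₁)ᵈ` with `2S₁ ≤ |T^{(k)}|_μ` the in-box coordinate difference is at most the torus distance (1.3):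
`|n_μ(y − q₁) − n_μ(ȳ − q₁)| ≤ |ȳ − y|`. [cite: Balaban1982Higgs1, (1.3) p.604] -/
theorem dist_offset_le_tdist (q₁ : HiggsLattice.Site P k) (S₁ : ℕ) (hS₁ : ∀ μ : Fin P.d, 2 * S₁ ≤ P.sitesPerDir k μ)
    {y ybar : HiggsLattice.Site P k} (hy : ∀ ν, (y ν - q₁ ν).val < S₁) (hybar : ∀ ν, (ybar ν - q₁ ν).val < S₁) (μ : Fin P.d) :
    Nat.dist (y μ - q₁ μ).val (ybar μ - q₁ μ).val ≤ HiggsLattice.Site.tdist ybar y := by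
  haveI : NeZero (P.sitesPerDir k μ) := ⟨(P.sitesPerDir_pos k μ).ne'⟩
  -- the key one-coordinate inequality, symmetric in `y, ȳ`
  have key : ∀ (a b : ZMod (P.sitesPerDir k μ)), a.val < S₁ → b.val < S₁ → b.val ≤ a.val →
      a.val - b.val ≤ min (b - a).val (a - b).val := by
    intro a b ha hb hba
    have h1 : (a - b).val = a.val - b.val := ZMod.val_sub hba
    by_cases hab : a.val = b.val
    · rw [hab, Nat.sub_self]; exact Nat.zero_le _
    · have hne : a - b ≠ 0 := by
        intro h0
        rw [h0, ZMod.val_zero] at h1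
        omega
      have h2 : (b - a).val = P.sitesPerDir k μ - (a.val - b.val) := by
        rw [← neg_sub, ZMod.neg_val, if_neg hne, h1]
      have hS := hS₁ μ
      refine le_min ?_ (le_of_eq h1.symm)
      rw [h2]; omega
  unfold HiggsLattice.Site.tdist
  refine le_trans ?_ (Finset.le_sup (f := fun ν : Fin P.d => min (ybar ν - y ν).val (y ν - ybar ν).val) (Finset.mem_univ μ))
  show Nat.dist (y μ - q₁ μ).val (ybar μ - q₁ μ).val ≤ min (ybar μ - y μ).val (y μ - ybar μ).val
  have eyb : ybar μ - y μ = (ybar μ - q₁ μ) - (y μ - q₁ μ) := by ring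
  have eyy : y μ - ybar μ = (y μ - q₁ μ) - (ybar μ - q₁ μ) := by ring
  rcases le_total (ybar μ - q₁ μ).val (y μ - q₁ μ).val with hle | hle
  · rw [Nat.dist_eq_sub_of_le_right hle, eyb, eyy]
    exact key _ _ (hy μ) (hybar μ) hle
  · rw [Nat.dist_eq_sub_of_le hle, eyb, eyy, min_comm]
    exact key _ _ (hybar μ) (hy μ) hle

/-- the ℓ¹ offset distance is at most `d` times the torus distance. [cite: Balaban1982Higgs1, (1.3) p.604] -/
theorem sum_dist_offset_le (q₁ : HiggsLattice.Site P k) (S₁ : ℕ) (hS₁ : ∀ μ : Fin P.d, 2 * S₁ ≤ P.sitesPerDir k μ)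
    {y ybar : HiggsLattice.Site P k} (hy : ∀ ν, (y ν - q₁ ν).val < S₁) (hybar : ∀ ν, (ybar ν - q₁ ν).val < S₁) :
    ∑ μ : Fin P.d, Nat.dist (y μ - q₁ μ).val (ybar μ - q₁ μ).val ≤ P.d * HiggsLattice.Site.tdist ybar y := by
  calc ∑ μ : Fin P.d, Nat.dist (y μ - q₁ μ).val (ybar μ - q₁ μ).val
      ≤ ∑ _μ : Fin P.d, HiggsLattice.Site.tdist ybar y :=
        Finset.sum_le_sum fun μ _ => dist_offset_le_tdist q₁ S₁ hS₁ hy hybar μ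
    _ = P.d * HiggsLattice.Site.tdist ybar y := by
        rw [Finset.sum_const, Finset.card_univ, Fintype.card_fin, smul_eq_mul]

end BoxArith

/-! ## §2 Telescoping a per-bond bound along lattice paths inside the box -/

section Telescope

/-- **TELESCOPING**: if `‖ψ(y + e_μ) − ψ(y)‖ ≤ λ₁` for every coarse bond with both ends in the box `□₁ = q₁ + [0,S₁)ᵈ`
(`2S₁ ≤ |T^{(k)}|_μ`), then `‖ψ(y) − ψ(ȳ)‖ ≤ λ₁·Σ_μ|n_μ(y−q₁) − n_μ(ȳ−q₁)|` for all `y, ȳ ∈ □₁` (induction on the ℓ¹ offset distance,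
moving one coordinate of `y` one step towards `ȳ` inside the box). [cite: Balaban1982Higgs2, Lemma 2.4 proof p.573 «After the gauge transformation we finally get |U(A₀(⟨y′, y″⟩))U(A₀(Γ_{y″,y}))φ′(y″) − U(A₀(Γ_{y′,y}))φ′(y′)| = |φ′(y″) − φ′(y′)| ≦ O(1)p(Lᵏε)»] -/
theorem lipschitz_of_bond_bound {E : Type*} [SeminormedAddCommGroup E] (q₁ : HiggsLattice.Site P k) (S₁ : ℕ)
    (hS₁ : ∀ μ : Fin P.d, 2 * S₁ ≤ P.sitesPerDir k μ) (ψ : HiggsLattice.Site P k → E) {lam₁ : ℝ}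
    (hb : ∀ (y : HiggsLattice.Site P k) (μ : Fin P.d), (∀ ν, (y ν - q₁ ν).val < S₁) →
      (∀ ν, ((y.shift μ) ν - q₁ ν).val < S₁) → ‖ψ (y.shift μ) - ψ y‖ ≤ lam₁) :
    ∀ (n : ℕ) (y ybar : HiggsLattice.Site P k), (∀ ν, (y ν - q₁ ν).val < S₁) → (∀ ν, (ybar ν - q₁ ν).val < S₁) →
      ∑ μ : Fin P.d, Nat.dist (y μ - q₁ μ).val (ybar μ - q₁ μ).val = n → ‖ψ y - ψ ybar‖ ≤ lam₁ * n := by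
  intro n
  induction n with
  | zero =>
      intro y ybar hy hybar hsum
      have h0 : ∀ μ, Nat.dist (y μ - q₁ μ).val (ybar μ - q₁ μ).val = 0 := fun μ =>
        (Finset.sum_eq_zero_iff.mp hsum) μ (Finset.mem_univ μ)
      have hyy : y = ybar := eq_of_offsets_eq q₁ y ybar fun μ => Nat.eq_of_dist_eq_zero (h0 μ)
      rw [hyy, sub_self, norm_zero, Nat.cast_zero, mul_zero]
  | succ n ih =>
      intro y ybar hy hybar hsum
      -- a coordinate where the offsets differ
      obtain ⟨μ, -, hμ⟩ : ∃ μ ∈ (Finset.univ : Finset (Fin P.d)), Nat.dist (y μ - q₁ μ).val (ybar μ - q₁ μ).val ≠ 0 :=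
        Finset.exists_ne_zero_of_sum_ne_zero (by rw [hsum]; exact Nat.succ_ne_zero n)
      have htS : (y μ - q₁ μ).val < S₁ := hy μ
      have htbS : (ybar μ - q₁ μ).val < S₁ := hybar μ
      have hSμ : 2 * S₁ ≤ P.sitesPerDir k μ := hS₁ μ
      have hn2 : 1 < P.sitesPerDir k μ := by omega
      -- split the sum at `μ`
      have hsplit : ∀ z : HiggsLattice.Site P k, ∑ ν : Fin P.d, Nat.dist (z ν - q₁ ν).val (ybar ν - q₁ ν).val
          = Nat.dist (z μ - q₁ μ).val (ybar μ - q₁ μ).val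
            + ∑ ν ∈ Finset.univ.erase μ, Nat.dist (z ν - q₁ ν).val (ybar ν - q₁ ν).val := fun z =>
        (Finset.add_sum_erase Finset.univ (fun ν => Nat.dist (z ν - q₁ ν).val (ybar ν - q₁ ν).val)
          (Finset.mem_univ μ)).symm
      have hne : (y μ - q₁ μ).val ≠ (ybar μ - q₁ μ).val := fun h => hμ (by rw [h, Nat.dist_self])
      rcases Nat.lt_or_gt_of_ne hne with hlt | hgt
      · -- `t < t̄`: move forward
        have hoff : ((y.shift μ) μ - q₁ μ).val = (y μ - q₁ μ).val + 1 := val_shift_offset q₁ y μ (by omega)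
        have hy'box : ∀ ν, ((y.shift μ) ν - q₁ ν).val < S₁ := by
          intro ν
          by_cases hν : ν = μ
          · rw [hν, hoff]; omega
          · rw [shift_apply_of_ne y hν]; exact hy ν
        have hstep : ‖ψ (y.shift μ) - ψ y‖ ≤ lam₁ := hb y μ hy hy'box
        have hsum' : ∑ ν : Fin P.d, Nat.dist ((y.shift μ) ν - q₁ ν).val (ybar ν - q₁ ν).val = n := by
          have e1 := hsplit (y.shift μ)
          have e2 := hsplit y
          have hrest : ∑ ν ∈ Finset.univ.erase μ, Nat.dist ((y.shift μ) ν - q₁ ν).val (ybar ν - q₁ ν).val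
              = ∑ ν ∈ Finset.univ.erase μ, Nat.dist (y ν - q₁ ν).val (ybar ν - q₁ ν).val := by
            refine Finset.sum_congr rfl fun ν hν => ?_
            rw [shift_apply_of_ne y (Finset.ne_of_mem_erase hν)]
          have hd1 : Nat.dist ((y μ - q₁ μ).val + 1) (ybar μ - q₁ μ).val + 1
              = Nat.dist (y μ - q₁ μ).val (ybar μ - q₁ μ).val := by
            rw [Nat.dist_eq_sub_of_le (Nat.succ_le_of_lt hlt), Nat.dist_eq_sub_of_le hlt.le]; omega
          rw [e1, hrest, hoff]
          rw [e2] at hsum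
          omega
        have hih := ih (y.shift μ) ybar hy'box hybar hsum'
        calc ‖ψ y - ψ ybar‖ ≤ ‖ψ y - ψ (y.shift μ)‖ + ‖ψ (y.shift μ) - ψ ybar‖ := norm_sub_le_norm_sub_add_norm_sub _ _ _
          _ ≤ lam₁ + lam₁ * n := add_le_add (by rw [norm_sub_rev]; exact hstep) hih
          _ = lam₁ * (n + 1 : ℕ) := by push_cast; ring
      · -- `t̄ < t`: move backward
        have hoff : ((y.unshift μ) μ - q₁ μ).val = (y μ - q₁ μ).val - 1 := val_unshift_offset q₁ y μ (by omega) hn2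
        have hy'box : ∀ ν, ((y.unshift μ) ν - q₁ ν).val < S₁ := by
          intro ν
          by_cases hν : ν = μ
          · rw [hν, hoff]; omega
          · rw [unshift_apply_of_ne y hν]; exact hy ν
        have hshift : (y.unshift μ).shift μ = y := shift_unshift y μ
        have hstep : ‖ψ y - ψ (y.unshift μ)‖ ≤ lam₁ := by
          have h := hb (y.unshift μ) μ hy'box (by rw [hshift]; exact hy)
          rwa [hshift] at h
        have hsum' : ∑ ν : Fin P.d, Nat.dist ((y.unshift μ) ν - q₁ ν).val (ybar ν - q₁ ν).val = n := by
          have e1 := hsplit (y.unshift μ)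
          have e2 := hsplit y
          have hrest : ∑ ν ∈ Finset.univ.erase μ, Nat.dist ((y.unshift μ) ν - q₁ ν).val (ybar ν - q₁ ν).val
              = ∑ ν ∈ Finset.univ.erase μ, Nat.dist (y ν - q₁ ν).val (ybar ν - q₁ ν).val := by
            refine Finset.sum_congr rfl fun ν hν => ?_
            rw [unshift_apply_of_ne y (Finset.ne_of_mem_erase hν)]
          have hd1 : Nat.dist ((y μ - q₁ μ).val - 1) (ybar μ - q₁ μ).val + 1
              = Nat.dist (y μ - q₁ μ).val (ybar μ - q₁ μ).val := by
            rw [Nat.dist_eq_sub_of_le_right (by omega : (ybar μ - q₁ μ).val ≤ (y μ - q₁ μ).val - 1),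
              Nat.dist_eq_sub_of_le_right hgt.le]
            omega
          rw [e1, hrest, hoff]
          rw [e2] at hsum
          omega
        have hih := ih (y.unshift μ) ybar hy'box hybar hsum'
        calc ‖ψ y - ψ ybar‖ ≤ ‖ψ y - ψ (y.unshift μ)‖ + ‖ψ (y.unshift μ) - ψ ybar‖ :=
            norm_sub_le_norm_sub_add_norm_sub _ _ _
          _ ≤ lam₁ + lam₁ * n := add_le_add hstep hih
          _ = lam₁ * (n + 1 : ℕ) := by push_cast; ring

/-- **LIPSCHITZ ABOUT `ȳ`**: under the per-bond bound on the box `□₁ = q₁ + [0,S₁)ᵈ` (`2S₁ ≤ |T^{(k)}|_μ`),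
`‖ψ(y) − ψ(ȳ)‖ ≤ λ₁·d·|ȳ − y|` for all `y, ȳ ∈ □₁` ((1.3) distance). [cite: Balaban1982Higgs2, Lemma 2.4 proof p.573 «After the gauge transformation we finally get |U(A₀(⟨y′, y″⟩))U(A₀(Γ_{y″,y}))φ′(y″) − U(A₀(Γ_{y′,y}))φ′(y′)| = |φ′(y″) − φ′(y′)| ≦ O(1)p(Lᵏε)»] -/
theorem lipschitz_about_of_bond_bound {E : Type*} [SeminormedAddCommGroup E] (q₁ : HiggsLattice.Site P k) (S₁ : ℕ)
    (hS₁ : ∀ μ : Fin P.d, 2 * S₁ ≤ P.sitesPerDir k μ) (ψ : HiggsLattice.Site P k → E) {lam₁ : ℝ} (hlam : 0 ≤ lam₁)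
    (hb : ∀ (y : HiggsLattice.Site P k) (μ : Fin P.d), (∀ ν, (y ν - q₁ ν).val < S₁) →
      (∀ ν, ((y.shift μ) ν - q₁ ν).val < S₁) → ‖ψ (y.shift μ) - ψ y‖ ≤ lam₁)
    {y ybar : HiggsLattice.Site P k} (hy : ∀ ν, (y ν - q₁ ν).val < S₁) (hybar : ∀ ν, (ybar ν - q₁ ν).val < S₁) :
    ‖ψ y - ψ ybar‖ ≤ lam₁ * P.d * (HiggsLattice.Site.tdist ybar y : ℝ) := by
  have h := lipschitz_of_bond_bound q₁ S₁ hS₁ ψ hb _ y ybar hy hybar rfl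
  refine h.trans ?_
  have hs := sum_dist_offset_le q₁ S₁ hS₁ hy hybar
  have hs' : ((∑ μ : Fin P.d, Nat.dist (y μ - q₁ μ).val (ybar μ - q₁ μ).val : ℕ) : ℝ)
      ≤ (P.d : ℝ) * (HiggsLattice.Site.tdist ybar y : ℝ) := by exact_mod_cast hs
  rw [mul_assoc]
  exact mul_le_mul_of_nonneg_left hs' hlam

end Telescope

/-! ## §3 From print's `A^{(k)}` on a coarse bond to the constant field `A₀` -/

section BarA

variable (C : ChargeData N)

/-- the straight segment of `Lᵏ` fine bonds under a coarse bond `⟨y, y + e_μ⟩` lies in the blocks of `y` and `y + e_μ`; so if both are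
in `□₂` every one of its bonds is inside `□ = B^k(□₂)`. [cite: Balaban1982Higgs2, (2.55) p.570] [cite: Balaban1982Higgs1, (1.20) p.607] -/
theorem inside_segment_of_mem (hk : k ≤ P.K) (sq₂ : Finset (HiggsLattice.Site P k)) {y : HiggsLattice.Site P k} {μ : Fin P.d}
    (hy : y ∈ sq₂) (hy' : y.shift μ ∈ sq₂) {i : ℕ} (hi : i < P.L ^ k) :
    Inside (underRegion k sq₂) (⟨shiftN (toFinest y) μ i, μ⟩ : HiggsLattice.PBond P 0) := by
  have hblk : ∀ t, t ≤ P.L ^ k → blockIter k (shiftN (toFinest y) μ t) ∈ sq₂ := by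
    intro t ht
    rcases blockIter_shiftN_of_le hk (toFinest y) μ ht with h | h
    · rw [h, blockIter_toFinest hk]; exact hy
    · rw [h, blockIter_toFinest hk]; exact hy'
  refine ⟨(mem_underRegion k sq₂ _).mpr (hblk i hi.le), ?_⟩
  show (shiftN (toFinest y) μ i).shift μ ∈ underRegion k sq₂
  rw [shiftN_succ, mem_underRegion]
  exact hblk (i + 1) hi

/-- **`|Ā^{(k)}_b − (A₀)_b| ≤ s`**: the block-averaged field (2.55) of `A` on a coarse bond of `□₂` is within `s` of the constant
field when `|A − A₀| ≤ s` on the bonds of `□` (an average of `Lᵏ` terms each within `s`). [cite: Balaban1982Higgs2, (2.55) p.570, Lemma 2.4 proof p.572 «|A′| = |A − A₀| ≤ O(1)p(Lᵏε)r(Lᵏε) on □»] -/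
theorem abs_barA_sub_const_le (hk : k ≤ P.K) (sq₂ : Finset (HiggsLattice.Site P k)) (A : HiggsLattice.VecField P 0)
    (c : Fin P.d → ℝ) {s : ℝ} (hAc : ∀ b : HiggsLattice.PBond P 0, Inside (underRegion k sq₂) b → |A b - c b.dir| ≤ s)
    {y : HiggsLattice.Site P k} {μ : Fin P.d} (hy : y ∈ sq₂) (hy' : y.shift μ ∈ sq₂) :
    |barA k A ⟨y, μ⟩ - c μ| ≤ s := by
  have hLk : (0 : ℝ) < (P.L : ℝ) ^ k := pow_pos (by exact_mod_cast P.hL) k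
  have e0 : barA k A ⟨y, μ⟩ = ((P.L : ℝ) ^ k)⁻¹ * ∑ i ∈ Finset.range (P.L ^ k), A ⟨shiftN (toFinest y) μ i, μ⟩ := rfl
  have e : barA k A ⟨y, μ⟩ - c μ
      = ((P.L : ℝ) ^ k)⁻¹ * ∑ i ∈ Finset.range (P.L ^ k), (A ⟨shiftN (toFinest y) μ i, μ⟩ - c μ) := by
    rw [e0, Finset.sum_sub_distrib, Finset.sum_const, Finset.card_range, nsmul_eq_mul, Nat.cast_pow, mul_sub,
      ← mul_assoc _ _ (c μ), inv_mul_cancel₀ hLk.ne', one_mul]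
  rw [e, abs_mul, abs_inv, abs_of_pos hLk]
  calc ((P.L : ℝ) ^ k)⁻¹ * |∑ i ∈ Finset.range (P.L ^ k), (A ⟨shiftN (toFinest y) μ i, μ⟩ - c μ)|
      ≤ ((P.L : ℝ) ^ k)⁻¹ * ∑ i ∈ Finset.range (P.L ^ k), |A ⟨shiftN (toFinest y) μ i, μ⟩ - c μ| :=
        mul_le_mul_of_nonneg_left (Finset.abs_sum_le_sum_abs _ _) (inv_nonneg.mpr hLk.le)
    _ ≤ ((P.L : ℝ) ^ k)⁻¹ * ∑ _i ∈ Finset.range (P.L ^ k), s := by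
        refine mul_le_mul_of_nonneg_left (Finset.sum_le_sum fun i hi => ?_) (inv_nonneg.mpr hLk.le)
        exact hAc _ (inside_segment_of_mem hk sq₂ hy hy' (Finset.mem_range.mp hi))
    _ = s := by rw [Finset.sum_const, Finset.card_range, nsmul_eq_mul, Nat.cast_pow, ← mul_assoc, inv_mul_cancel₀ hLk.ne', one_mul]

/-- **FROM `A^{(k)}` TO `A₀` ON A COARSE BOND** (print's first displayed line p.573 from «the restrictions (2.55) on the field φ»): the
(2.55)₃-type per-bond bound `‖U_{Lᵏε}(Ā^{(k)}_{⟨y,y+e_μ⟩})φ(y + e_μ) − φ(y)‖ ≤ λ_A` (`Ā^{(k)}` the block-averaged field of (2.55),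
`U_{Lᵏε}(Ā^{(k)}_b) = Π U_ε(A)` over the straight segment) gives the constant-field bound
`‖U_{Lᵏε}(c_μ)φ(y + e_μ) − φ(y)‖ ≤ λ_A + (Lᵏε)|e|s‖φ(y + e_μ)‖` when `|A − A₀| ≤ s` on `□` and `y, y + e_μ ∈ □₂`.
[cite: Balaban1982Higgs2, Lemma 2.4 proof p.573 «The estimates of the covariant derivatives give us |U(A₀(⟨y′, y″⟩))φ(y″) − φ(y′)| ≦ O(1)p(Lᵏε)»] -/
theorem cov_const_of_cov_barA (hk : k ≤ P.K) (sq₂ : Finset (HiggsLattice.Site P k)) (A : HiggsLattice.VecField P 0)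
    (c : Fin P.d → ℝ) {s : ℝ} (hAc : ∀ b : HiggsLattice.PBond P 0, Inside (underRegion k sq₂) b → |A b - c b.dir| ≤ s)
    (φ : HiggsLattice.ScalarField P k N) {y : HiggsLattice.Site P k} {μ : Fin P.d} (hy : y ∈ sq₂) (hy' : y.shift μ ∈ sq₂)
    {lamA : ℝ} (hcovA : ‖C.U (P.mesh k) (barA k A ⟨y, μ⟩) (φ (y.shift μ)) - φ y‖ ≤ lamA) :
    ‖C.U (P.mesh k) (c μ) (φ (y.shift μ)) - φ y‖ ≤ lamA + P.mesh k * |C.e| * s * ‖φ (y.shift μ)‖ := by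
  have hmesh : 0 < P.mesh k := P.mesh_pos k
  have h1 : ‖C.U (P.mesh k) (c μ) (φ (y.shift μ)) - C.U (P.mesh k) (barA k A ⟨y, μ⟩) (φ (y.shift μ))‖
      ≤ P.mesh k * |C.e| * s * ‖φ (y.shift μ)‖ := by
    refine (norm_U_apply_sub_U_apply_le C (P.mesh k) (c μ) (barA k A ⟨y, μ⟩) (φ (y.shift μ))).trans ?_
    refine mul_le_mul_of_nonneg_right ?_ (norm_nonneg _)
    rw [abs_mul, abs_mul, abs_of_pos hmesh, abs_sub_comm]
    exact mul_le_mul_of_nonneg_left (abs_barA_sub_const_le hk sq₂ A c hAc hy hy') (by positivity)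
  calc ‖C.U (P.mesh k) (c μ) (φ (y.shift μ)) - φ y‖
      ≤ ‖C.U (P.mesh k) (c μ) (φ (y.shift μ)) - C.U (P.mesh k) (barA k A ⟨y, μ⟩) (φ (y.shift μ))‖
          + ‖C.U (P.mesh k) (barA k A ⟨y, μ⟩) (φ (y.shift μ)) - φ y‖ := norm_sub_le_norm_sub_add_norm_sub _ _ _
    _ ≤ P.mesh k * |C.e| * s * ‖φ (y.shift μ)‖ + lamA := add_le_add h1 hcovA
    _ = lamA + P.mesh k * |C.e| * s * ‖φ (y.shift μ)‖ := add_comm _ _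

end BarA

/-! ## §4 (2.65) with the printed covariant per-bond hypothesis -/

section Eq265Cov

/-- **LEMMA 2.4 (2.65), VALUE CLAUSE, ON THE (Higgs)₂,₃ CARRIER — hypothesis (c) in the printed covariant form.**  As
`B2Eq265HiggsRegion.eq265_higgs_region`, except that the Lipschitz hypothesis on the gauged field is REPLACED by the covariant
per-bond bound `‖U_{Lᵏε}(Ā^{(k)}_{⟨y,y+e_μ⟩})φ(y + e_μ) − φ(y)‖ ≤ λ_A` for the coarse bonds `⟨y, y + e_μ⟩` with both ends in `□₁`
(`Ā^{(k)}` the block-averaged field of (2.55); print: «Now let us consider the restrictions (2.55) on the field φ. The estimates of the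
covariant derivatives give us |U(A₀(⟨y′, y″⟩))φ(y″) − φ(y′)| ≦ O(1)p(Lᵏε)» — that line is DERIVED here from the bound at `A^{(k)}`),
where `□₁` IS a box `q₁ + [0,S₁)ᵈ` of coarse sites with `2S₁ ≤ |T^{(k)}|_μ`; the constant `λ` of F5 becomes `(λ_A + (Lᵏε)|e|st′)·d`. [cite: Balaban1982Higgs2, Lemma 2.4 (2.65) p.572]
[cite: Balaban1982Higgs2, Lemma 2.4 proof p.573 «The estimates of the covariant derivatives give us |U(A₀(⟨y′, y″⟩))φ(y″) − φ(y′)| ≦ O(1)p(Lᵏε)»]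
[cite: Balaban1982Higgs2, Lemma 2.4 proof p.573 «After the gauge transformation we finally get |U(A₀(⟨y′, y″⟩))U(A₀(Γ_{y″,y}))φ′(y″) − U(A₀(Γ_{y′,y}))φ′(y′)| = |φ′(y″) − φ′(y′)| ≦ O(1)p(Lᵏε)»] -/
theorem eq265_higgs_region_cov (d L : ℕ) (hd : 1 ≤ d) (hL : 2 ≤ L) {a : ℝ} (ha : 0 < a) {msq : ℝ} (hmsq : 0 < msq)
    (N : ℕ) (C : ChargeData N) (ε₀ : ℝ) (creg β : ℝ) (hcreg : 0 ≤ creg) (hβ : 0 < β) :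
    ∃ K₀min : ℕ, ∀ K₀ : ℕ, K₀min ≤ K₀ → ∃ e₁ t : ℝ, 0 < e₁ ∧ 0 < t ∧
      ∃ C₁ C₂ C₃ D₁ D₂ D₃ D₄ : ℝ, 0 ≤ C₁ ∧ 0 ≤ C₂ ∧ 0 ≤ C₃ ∧ 0 ≤ D₁ ∧ 0 ≤ D₂ ∧ 0 ≤ D₃ ∧ 0 ≤ D₄ ∧
      ∀ (P : HiggsLattice.Params), P.d = d → P.L = L → K₀ ∣ P.M →
      ∀ {k : ℕ}, 1 ≤ k → k ≤ P.K → (∀ μ, 3 * half P k K₀ ≤ P.sitesPerDir 0 μ) → P.mesh k ≤ ε₀ → P.mesh k ≤ 1 →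
      ∀ (Λ₂ Λ₆ sq₂ sq₁ : Finset (HiggsLattice.Site P k)) (S : Fin P.d → Finset ℕ) (q : HiggsLattice.Site P k) (Sbox : ℕ),
        Λ₆ ⊆ Λ₂ → sq₂ ⊆ Λ₂ → sq₁ ⊆ sq₂ → sq₁ ⊆ Λ₆ →
        IsBigBlockUnion k K₀ (underRegion k Λ₂) → underRegion k sq₂ = cellBox k K₀ S →
        (∀ μ : Fin P.d, P.L ^ k * Sbox < P.sitesPerDir 0 μ) → (∀ y ∈ sq₂, ∀ μ : Fin P.d, (y μ - q μ).val < Sbox) →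
      -- `□₁` is a box of coarse sites, smaller than half the torus
      ∀ (q₁ : HiggsLattice.Site P k) (S₁ : ℕ), (∀ μ : Fin P.d, 2 * S₁ ≤ P.sitesPerDir k μ) →
        (∀ y : HiggsLattice.Site P k, y ∈ sq₁ ↔ ∀ ν : Fin P.d, (y ν - q₁ ν).val < S₁) →
      ∀ (A : HiggsLattice.VecField P 0) {ec : ℝ}, 0 < ec → ec ≤ e₁ →
        (∀ z ∈ underRegion k Λ₂, ∀ μ ν : Fin P.d,
            P.mesh k * |C.e| / ec * |A ⟨z.shift μ, ν⟩ - A ⟨z, ν⟩| ≤ creg * ec ^ (β - 1) / (P.L : ℝ) ^ k) →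
        ∀ {δA : ℝ}, 0 ≤ δA →
          (∀ z ∈ underRegion k sq₂, ∀ μ ν : Fin P.d, |A ⟨z.shift ν, μ⟩ - A ⟨z, μ⟩| ≤ δA) →
          (P.L : ℝ) ^ k * δA * |C.e| ≤ t →
        ∀ (c : Fin P.d → ℝ) {s : ℝ}, 0 ≤ s →
          (∀ b : HiggsLattice.PBond P 0, Inside (underRegion k sq₂) b → |A b - c b.dir| ≤ s) →
      ∀ (x : HiggsLattice.Site P 0),
        (∀ z, HiggsLattice.Site.tdist x z ≤ 2 * rS P k K₀ + 2 * half P k K₀ * (P.d + 1) + 1 → z ∈ underRegion k sq₂) →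
        blockIter k x ∈ sq₁ →
      ∀ (φ : HiggsLattice.ScalarField P k N) {t' : ℝ}, 0 ≤ t' → (∀ y ∈ Λ₆, ‖φ y‖ ≤ t') →
        -- the (2.55)₃-type covariant per-bond bound at `Ā^{(k)}` on the bonds of `□₁`
        ∀ {lamA : ℝ}, 0 ≤ lamA →
          (∀ (y : HiggsLattice.Site P k) (μ : Fin P.d), y ∈ sq₁ → y.shift μ ∈ sq₁ →
            ‖C.U (P.mesh k) (barA k A ⟨y, μ⟩) (φ (y.shift μ)) - φ y‖ ≤ lamA) →
        ∀ {ρ : ℝ}, (∀ y : HiggsLattice.Site P k, y ∉ sq₁ → ρ ≤ (HiggsLattice.Site.tdist (blockIter k x) y : ℝ)) →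
        ‖bgScalar256 C msq a k Λ₂ Λ₆ A φ x - avgQkAdj C A k φ x‖
          ≤ B1.aSeq a P.L k * t' *
                (C₁ * Real.exp (-(1 / (4 * K₀) * (distC (underRegion k sq₂) x / (P.L : ℝ) ^ k)))
                  + C₂ * Real.exp (-(1 / (4 * K₀) * ρ)))
            + (D₁ * P.mesh k ^ 2 *
                (B1.aSeq a P.L k * (P.mesh k)⁻¹ ^ 2 * (|C.e| * s * P.mesh 0 * (P.d * ((P.L : ℝ) ^ k - 1))) * t'
                  + |C.e| * s * (P.d * ((B1.aSeq a P.L k * (P.mesh k)⁻¹ ^ 2 * t' * D₄ * P.mesh k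
                        + |C.e| * s * (B1.aSeq a P.L k * D₃ * t')) + |C.e| * s * (B1.aSeq a P.L k * D₃ * t')))
                  + B1.aSeq a P.L k * (P.mesh k)⁻¹ ^ 2 *
                      ((2 * (|C.e| * s * P.mesh 0 * (P.d * ((P.L : ℝ) ^ k - 1)))
                        + (|C.e| * s * P.mesh 0 * (P.d * ((P.L : ℝ) ^ k - 1))) ^ 2) * (B1.aSeq a P.L k * D₃ * t')))
              + D₂ * P.mesh k * (|C.e| * s * (B1.aSeq a P.L k * D₃ * t')))
            + B1.aSeq a P.L k * C₃ *
                (4 * K₀ * ((lamA + P.mesh k * |C.e| * s * t') * P.d) + Real.exp (-(1 / (4 * K₀) * ρ)) * t')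
            + msq * P.mesh k ^ 2 / (B1.aSeq a P.L k + msq * P.mesh k ^ 2) * t'
            + |C.e| * P.mesh 0 * (P.d * ((P.L : ℝ) ^ k - 1)) * s * t' := by
  obtain ⟨K₀min, h⟩ := eq265_higgs_region d L hd hL ha hmsq N C ε₀ creg β hcreg hβ
  refine ⟨K₀min, fun K₀ hK₀ => ?_⟩
  obtain ⟨e₁, t, he₁, ht, C₁, C₂, C₃, D₁, D₂, D₃, D₄, hC₁, hC₂, hC₃, hD₁, hD₂, hD₃, hD₄, h⟩ := h K₀ hK₀
  refine ⟨e₁, t, he₁, ht, C₁, C₂, C₃, D₁, D₂, D₃, D₄, hC₁, hC₂, hC₃, hD₁, hD₂, hD₃, hD₄, ?_⟩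
  intro P hPd hPL hK₀M k hk1 hkK h3 hε h1 Λ₂ Λ₆ sq₂ sq₁ S q Sbox h62 hs2 h12 h16 hΩΛ hbox hSbox hq q₁ S₁ hS₁ hsq₁ A ec hec
    hle hreg δA hδA hregbox ht' c s hs hAc x hx hxsq φ t' ht0 hφ lamA hlamA hcovA ρ hρ
  have hmesh : 0 < P.mesh k := P.mesh_pos k
  -- the constant-field per-bond bound on `□₁`, constant `λ₁ = λ_A + (Lᵏε)|e|st′`
  have hcov : ∀ (y : HiggsLattice.Site P k) (μ : Fin P.d), (∀ ν, (y ν - q₁ ν).val < S₁) →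
      (∀ ν, ((y.shift μ) ν - q₁ ν).val < S₁) →
      ‖C.U (P.mesh k) (c μ) (φ (y.shift μ)) - φ y‖ ≤ lamA + P.mesh k * |C.e| * s * t' := by
    intro y μ hy hy'
    have hy1 : y ∈ sq₁ := (hsq₁ y).mpr hy
    have hy1' : y.shift μ ∈ sq₁ := (hsq₁ _).mpr hy'
    refine (cov_const_of_cov_barA C hkK sq₂ A c hAc φ (h12 hy1) (h12 hy1') (hcovA y μ hy1 hy1')).trans ?_
    have := hφ _ (h16 hy1')
    have hnn : 0 ≤ P.mesh k * |C.e| * s := by positivity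
    nlinarith
  -- the per-bond bound for the gauged field (F5's displayed identity)
  set ψ := rot C (fun z => cornerGauge (toFinest q) c (toFinest z)) φ with hψ
  have hb : ∀ (y : HiggsLattice.Site P k) (μ : Fin P.d), (∀ ν, (y ν - q₁ ν).val < S₁) →
      (∀ ν, ((y.shift μ) ν - q₁ ν).val < S₁) → ‖ψ (y.shift μ) - ψ y‖ ≤ lamA + P.mesh k * |C.e| * s * t' := by
    intro y μ hy hy'
    have hy2 : y ∈ sq₂ := h12 ((hsq₁ y).mpr hy)
    have hy2' : y.shift μ ∈ sq₂ := h12 ((hsq₁ _).mpr hy')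
    rw [hψ, norm_rot_cornerGauge_shift_sub C hkK q Sbox hSbox c φ (hq y hy2) (hq _ hy2')]
    exact hcov y μ hy hy'
  -- Lipschitz about `ȳ` on `□₁` with constant `λ₁·d`
  have hlip : ∀ y ∈ sq₁, ‖ψ y - ψ (blockIter k x)‖
      ≤ (lamA + P.mesh k * |C.e| * s * t') * P.d * (HiggsLattice.Site.tdist (blockIter k x) y : ℝ) :=
    fun y hy => lipschitz_about_of_bond_bound q₁ S₁ hS₁ ψ (by positivity) hb ((hsq₁ y).mp hy) ((hsq₁ _).mp hxsq)
  have hlam' : 0 ≤ (lamA + P.mesh k * |C.e| * s * t') * P.d := by positivity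
  have hmain := h P hPd hPL hK₀M hk1 hkK h3 hε h1 Λ₂ Λ₆ sq₂ sq₁ S q Sbox h62 hs2 h12 h16 hΩΛ hbox hSbox hq A hec hle hreg hδA
    hregbox ht' c hs hAc x hx hxsq φ ht0 hφ hlam' hlip hρ
  rw [hPd] at hmain ⊢
  exact hmain

end Eq265Cov

end Literature.MathematicalPhysics.QuantumFieldTheory.Balaban1983to89.B2Eq265GaugedLipschitz

end
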